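/-
Origin: expansion seat `prover-pub-hodgecm-mc-binder-1-0`, handover #4 2026-08-18T18:53Z md5 6d15a7de44a7c4fee4974eed4c092b6b (NEW, 241 l., new subdir HodgeCM/Model/Binders/; rewrites import McB1.IchinoFockKTypesLines -> HodgeCM.Literature.IchinoFockKTypesLines x1, import McB1.IchinoFockKTypesPlanes -> HodgeCM.Literature.IchinoFockKTypesPlanes x1; audited names: HodgeCM.Model.Binders.ArchWeightDictionary.pPlus_harmonic_iff_posLine, HodgeCM.Model.Binders.ArchWeight (`HOME/mc/pub-hodgecm-mc-binder-1/lean/McB1/ArchWeightDictionary.lean`, md5 6d15a7de, 241 lines);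
landed by the packager successor (mc-unitary-1-g3, gen-8 kit) in gate run 32 as `HodgeCM/Model/Binders/ArchWeightDictionary.lean` (import ^import McB1\.IchinoFockKTypesLines[ \t]*$→import HodgeCM.Literature.IchinoFockKTypesLines ×1; import ^import McB1\.IchinoFockKTypesPlanes[ \t]*$→import HodgeCM.Literature.IchinoFockKTypesPlanes ×1).
-/
/-
Copyright (c) 2026 the pub-hodgecm formalisation cell (harness21).  New file, not vendored.
Origin: HOME/mc/pub-hodgecm-mc-binder-1/lean/McB1/ArchWeightDictionary.lean — session prover-pub-hodgecm-mc-binder-1-0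
(unit pub-hodgecm-mc-binder-1, MODEL-CONSTRUCTION sub-cell, BINDER PROVER hbr/hQ/hch).  Intended final place:
`HodgeCM/Model/Binders/ArchWeightDictionary.lean` (module `HodgeCM.Model.Binders.ArchWeightDictionary`).  Imports (TWO
rewrites): `McB1.IchinoFockKTypesLines` ↦ `HodgeCM.Literature.IchinoFockKTypesLines`, `McB1.IchinoFockKTypesPlanes` ↦
`HodgeCM.Literature.IchinoFockKTypesPlanes`.  KIND: KERNEL over ONE cited lemma taken as a hypothesis
(`FockHarmonics.Lemma_7_10` = [Ich22] §7.5 Lemma 7.10); nothing of PerL / QW8 / the 2001 programme is used as a source.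
-/
import Summits.HodgeConjecture.HodgeCM.Literature.IchinoFockKTypesLines
import Summits.HodgeConjecture.HodgeCM.Literature.IchinoFockKTypesPlanes

set_option autoImplicit false

/-!
# Binder Γ1 (archimedean weight dictionary of `hch`(β) / `hQ` / `A12` / `A34`): PerL v5 §4.1's Fock bookkeeping
# sentences READ OFF a printed lemma with splitting characters — [Ich22] Lemma 7.10

BINDER-TRIAGE.md §2 isolated, as the only content of the seven non-print binders that was "neither kernel nor verbatim
print", the item **Γ1** = PerL v5 §4.1 opening paragraph + Lemma 4.1(a)(b) (tex ll. 472–513 of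
`inputs/2001/…paper-v5-d912a121.tex`): the vacuum / lowest-`K`-type bookkeeping of the Fock models of the local Weil
representations `ω_{W_i,b}`, `ω_{W,b}` UNDER PerL'S SPLITTING CHARACTERS — supported in PerL only by "[Y1neg] Lemmas
3.1/3.2" (not citable), labelled INPUT in `HodgeCM.PerL34.ArchBookkeeping` (N26: "the EXISTENCE of `φ⁰` … is [Y1neg]
Lemmas 3.1/3.2"), `HodgeCM.PerL34.ArchCFock.FockArchBridge.w_loc` (N26/N28), `HodgeCM.PerL34.QautFock.QautFockBridge`
(`Ψ_j` on the `J⁺`-piece, Lemma 4.1(a)), and flagged as normalisation-SENSITIVE by GAPS pv12g7-2 (the central twist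
`det_V^{−1}`: "TO CHECK FROM PRINT").

The printed source with splitting characters EXISTS (GAPS ff2-X1): A. Ichino, *Theta lifting for tempered
representations of real unitary groups*, Adv. Math. 398 (2022) 108188, §4.1 + §7.5 **Lemma 7.10** — transcribed
verbatim (dictionary `FockHarmonics.corresponds` = "`μ ⊠ μ′` occurs in the joint harmonics `ℋ` of the Fock model of
`ω_{V,W,χ_V,χ_W,ψ}`", REAL weights `HarmonicParam.mu/mu'`, predicate `Lemma_7_10`) in
`HodgeCM.Literature.IchinoFockKTypes` (= hub tree `Literature.RepresentationTheory.Ichino2022.FockKTypeCorrespondence`),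
with eight special cases PROVED from it by arithmetic in `…IchinoFockKTypesLines/Planes`.  THIS FILE states PerL's
sentences in PerL's parameters and derives each from `(h : D.Lemma_7_10)`:

## The D5 dictionary (DATA — the object-match sentence; recorded, NOT claimed; referee code B2)

PerL's local datum at a real place `b` of `L₀` ↦ Ichino's `SplittingDatum`:
* `U(W)` side: PerL's hermitian line `W_{i,b}` of sign `+`/`−` (resp. the plane `W_b = W_{1,b} ⊕ W_{2,b}`) ↦ Ichino's
  skew-Hermitian `W` (multiply the form by `√−1`; which sign becomes `(p,q) = (1,0)` is part of the match) of
  signature `(1,0)`/`(0,1)` (resp. `(2,0)`, `(0,2)`, `(1,1)`);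
* `U(V)` side: `V₃ ⊗ L_{0,b}` ↦ `V` of signature `(r,s) = (2,1)` at `b = ι₁`, `(3,0)` at `b ≠ ι₁`;
* PerL's splitting character of the LINE, `μ_{i,b}(z) = (z/|z|)^{m_b}` with `m_b = m_b(Ψ_i)` resp. `m_hol` (tex l. 472–474)
  ↦ Ichino's `χ_W`, i.e. **`n₀ = m_b`**; for the plane `μ_W = μ₁μ₂` (Def 3.2, l. 278; [HKS96] Cor A.3) ↦ `n₀ = m_b(Ψ₁) + m_b(Ψ₂)`;
* PerL's `χ_V` (fixed once, l. 259–262) ↦ Ichino's `χ_V`, exponent `m₀` (odd).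
Under this dictionary "`U(W_{i,b})` acts on `φ` by `u ↦ u^{−e}`" ↦ "the `U(1)`-type paired with the `K′`-type of `φ`
is the weight `−e`", so PerL's DEFINED integer `e_b(Ψ_i)` (l. 476) is `−(U(1)`-weight`)`.

## What is proved (every statement: hypotheses `D : FockHarmonics S`, `h : D.Lemma_7_10`, and the signature entries)

* §1 `b ≠ ι₁` (N26, l. 475 "it is the vacuum line, [Y1neg, Lemma 3.2]"; L4.1(b) pf ll. 497–500 "in the model of a
  positive line the vacuum character is `det^{(m+1)/2}` and `𝟏` occurs iff `m = −1`; for a negative line … iff `m = +1`"):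
  `trivial_harmonic_iff_posLine` / `_negLine` — WITH the explicit paired `U(1)`-weight `(3+m₀)/2` resp. `(m₀−3)/2`, whence
  `e_b = −(3+m₀)/2` (positive) / `(3−m₀)/2` (negative) depends on the SIGN only (l. 477 "so does `e_b(Ψ_i)`") —
  `eOfSign`, `eOfSign_spec_pos/neg`.
* §2 `b = ι₁`, lines (N27 / L4.1(a), l. 475–476 "the harmonic `z₁` generating `J⁺` ([Y1neg, Lemma 3.1])"; ff2-X1: "`𝔭₊` occurs
  iff (positive, `m = −1`), once"): `pPlus_harmonic_iff_posLine` (type `𝔭₊ = (1,0;−1)` harmonic iff `n₀ = −1`, paired with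
  `U(1)`-weight `(3+m₀)/2`, so `e_{ι₁} = −(3+m₀)/2` "independent of `i`", l. 478) and `pPlus_not_harmonic_negLine`.
* §3 `b = ι₁`, the plane (N28 / L4.1(b) pf ll. 505–510 "`𝓕^κ_{ι₁} = ℂ det(z)` … on which `U(W_{ι₁}) = U(2)_W` acts by `det`
  (times the vacuum character)", vacuum label `(0,0;−2)`): `wedge_harmonic_iff_plane` — UNDER PerL's splitting
  (`n₀ = (−1) + (−1) = −2`, hypothesis `hn`) the type `κ = (1,1;−2)` is harmonic iff `μ` is the CHARACTER
  `((3+m₀)/2, (3+m₀)/2) = det ⊗ (vacuum character)`; and `wedge_harmonic_n0_zero` — in the untwisted normalisation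
  `n₀ = 0` it is paired with a TWO-dimensional `U(2)`-type instead (GAPS pv12g7-2's observation, now from print): so
  PerL's sentence is exactly the `n₀ = −2` case, and `n₀ = −2` IS what Def 3.2 / Lemma 3.3(a) prescribe at `ι₁`
  (`μ_W = μ₁μ₂`, both lines of sign `ε_hol` with `m_hol = −1`).  The torus `T_b = U(W₁) × U(W₂)` (diagonal in `U(2)_W`)
  acts on a CHARACTER `(t,t)` of `U(2)` by `(t,t)` = `(−e_{ι₁}(Ψ₁), −e_{ι₁}(Ψ₂))` — `plane_weight_eq_line_weights`.
* §4 `b ∈ D₁₂ ∪ Σ₁₂` (L4.1(b) pf ll. 497–505: definite planes `++`/`−−` have `U(3)`-invariants = constants iff both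
  vacuum twists are trivial; the `(1,1)` plane has invariants `ℂ[P] = 𝒰(𝔭′⁺)·1`): `trivial_harmonic_iff_posPlane`
  (`n₀ = −2`), `_negPlane` (`n₀ = +2`), `_mixedPlane` (`n₀ = 0`), each with the paired `T_b`-character — and
  `splitting_exponents_consistent`: the per-LINE conditions of §1 (`m = −1` for `+`, `m = +1` for `−`) add up to exactly
  the per-PLANE conditions (`−2`, `+2`, `0`) under `n₀(W) = n₀(W₁) + n₀(W₂)`.

What is NOT here (by design): the Fock model itself and the object match D5 (B2) — "the model's `ω_{W,b}` IS
`ω_{V,W,χ_V,χ_W,ψ}` of [Ich22] with the dictionary above" is what the construction sub-cell must make definitional; the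
structure facts "`ℋ_{μ⊠μ′}` has multiplicity one / generates `𝓕_μ` under `𝒰(𝔭′⁺)`" ([Ad07] Thm 6.3, typed in
`HodgeCM.Literature.CohomologicalIsolation` as `CompactDualPairFock.Adams_Thm_6_3`) and "`θ_{2,1}`(character) `= A_𝔮(λ′)`"
([Ich22] Thm 4.1(1)) are cited THERE / not needed for the weight bookkeeping.
-/

namespace HodgeCM
namespace Model
namespace Binders
namespace ArchWeightDictionary

open HodgeCM.Literature.Ichino2022 HodgeCM.Literature.Ichino2022.FockHarmonics
  HodgeCM.Literature.Ichino2022.WorkedLines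

variable {S : SplittingDatum} (D : FockHarmonics S)

/-! ## §1 Definite places `b ≠ ι₁`: lines against `U(3)` (node N26; L4.1(b) pf ll. 497–500) -/

/-- **PerL v5 l. 475 + ll. 497–499, positive line at a definite place, FROM PRINT**: in the Fock model of
`ω_{W_{i,b}}` for a POSITIVE line (`(p,q) = (1,0)`) against `U(3)` (`(r,s) = (3,0)`), the trivial `U(3)`-type is
harmonic iff the line's splitting exponent is `n₀ = m_b = −1` ("`𝟏` occurs iff `m = −1`"), and then it is paired with
the `U(1)`-character of weight `(3 + m₀)/2` ("vacuum character"; so `e_b(Ψ_i) = −(3+m₀)/2`). -/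
theorem trivial_harmonic_iff_posLine (h : D.Lemma_7_10) (hp : S.p = 1) (hq : S.q = 0) (hr : S.r = 3)
    (hs : S.s = 0) (μ : KWt S.p S.q) (μ' : KWt S.r S.s) (hμ' : ∀ i, μ'.1 i = 0) :
    D.corresponds μ μ' ↔ S.n₀ = -1 ∧ ∀ i, μ.1 i = (3 + (S.m₀ : ℚ)) / 2 := by
  rw [corresponds_trivial_iff_posLine D h hp hq hs (by omega) μ μ' hμ', hr]
  norm_num

/-- **PerL v5 ll. 499–500, negative line at a definite place, FROM PRINT**: (`(p,q) = (0,1)`, `(r,s) = (3,0)`) the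
trivial `U(3)`-type is harmonic iff `n₀ = m_b = +1`, paired with the `U(1)`-character of weight `(m₀ − 3)/2`
(so `e_b(Ψ_i) = (3 − m₀)/2`). -/
theorem trivial_harmonic_iff_negLine (h : D.Lemma_7_10) (hp : S.p = 0) (hq : S.q = 1) (hr : S.r = 3)
    (hs : S.s = 0) (μ : KWt S.p S.q) (μ' : KWt S.r S.s) (hμ' : ∀ i, μ'.1 i = 0) :
    D.corresponds μ μ' ↔ S.n₀ = 1 ∧ ∀ j, μ.2 j = ((S.m₀ : ℚ) - 3) / 2 := by
  rw [corresponds_trivial_iff_negLine D h hp hq hs (by omega) μ μ' hμ', hr]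
  norm_num

/-- **`e_b` as a function of the SIGN of the line** (PerL l. 476–477: "`U(W_{i,b}) = U(1)` acts on it by a character
`u ↦ u^{−e_b(Ψ_i)}`, which defines `e_b(Ψ_i) ∈ ℤ` … so does `e_b(Ψ_i)` [depend only on the sign]"): minus the
`U(1)`-weight of §1, as a rational (it is an integer since `m₀` is odd: `eOfSign_int`). -/
def eOfSign (pos : Bool) (m₀ : ℤ) : ℚ := if pos then -((3 + (m₀ : ℚ)) / 2) else (3 - (m₀ : ℚ)) / 2

/-- `e` is an integer for odd `m₀`. -/
theorem eOfSign_int (pos : Bool) {m₀ : ℤ} (hm : m₀ ≡ 3 [ZMOD 2]) : ∃ z : ℤ, eOfSign pos m₀ = z := by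
  obtain ⟨k, hk⟩ := hm.dvd
  have hm' : (m₀ : ℚ) = 3 - 2 * k := by
    have : (m₀ : ℤ) = 3 - 2 * k := by linarith
    exact_mod_cast this
  cases pos with
  | false => exact ⟨k, by rw [eOfSign, if_neg (by decide), hm']; ring⟩
  | true => exact ⟨k - 3, by rw [eOfSign, if_pos rfl, hm']; push_cast; ring⟩

/-- The `U(1)`-weight paired with `𝟏_{U(3)}` for a positive line is `−e`. -/
theorem eOfSign_spec_pos (m₀ : ℤ) : (3 + (m₀ : ℚ)) / 2 = -eOfSign true m₀ := by
  simp [eOfSign]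

/-- The `U(1)`-weight paired with `𝟏_{U(3)}` for a negative line is `−e`. -/
theorem eOfSign_spec_neg (m₀ : ℤ) : ((m₀ : ℚ) - 3) / 2 = -eOfSign false m₀ := by
  simp [eOfSign]; ring

/-! ## §2 The place `ι₁`: lines against `U(2,1)` (node N27 / Lemma 4.1(a), ll. 475–482, 493–496) -/

/-- **PerL v5 l. 475–476 / L4.1(a), FROM PRINT**: for a POSITIVE line at `ι₁` (`(1,0;2,1)`) the `K_V = U(2) × U(1)`-type
`𝔭₊ = (1,0;−1)` (the type of holomorphic one-forms, lowest `K`-type of `J⁺`) is harmonic iff `n₀ = m_hol = −1`, and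
then it is paired with the `U(1)`-character of weight `(3 + m₀)/2` — the SAME weight as at the definite places for a
positive line (`e_{ι₁} = eOfSign true m₀`, "independent of `i`", l. 478). -/
theorem pPlus_harmonic_iff_posLine (h : D.Lemma_7_10) (hp : S.p = 1) (hq : S.q = 0) (hr : S.r = 2)
    (hs : S.s = 1) (μ : KWt S.p S.q) (μ' : KWt S.r S.s)
    (h0 : μ'.1 ⟨0, by omega⟩ = 1) (h1 : μ'.1 ⟨1, by omega⟩ = 0) (h2 : μ'.2 ⟨0, by omega⟩ = -1) :
    D.corresponds μ μ' ↔ S.n₀ = -1 ∧ ∀ i, μ.1 i = -eOfSign true S.m₀ := by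
  have he : -eOfSign true S.m₀ = (3 + (S.m₀ : ℚ)) / 2 := by
    rw [eOfSign, if_pos rfl]; ring
  rw [corresponds_pPlus_iff_posLine D h hp hq hr hs μ μ' h0 h1 h2, he]

/-- **FROM PRINT**: a NEGATIVE line at `ι₁` (`(0,1;2,1)`) never has `𝔭₊` among its harmonics — its theta lifts carry no
holomorphic one-form (consistent with `s_{ι₁}(W_i) = ε_hol` being the positive sign, Lemma 3.3(a) l. 284). -/
theorem pPlus_not_harmonic_negLine (h : D.Lemma_7_10) (hp : S.p = 0) (hq : S.q = 1) (hr : S.r = 2)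
    (hs : S.s = 1) (μ : KWt S.p S.q) (μ' : KWt S.r S.s)
    (h0 : μ'.1 ⟨0, by omega⟩ = 1) (h1 : μ'.1 ⟨1, by omega⟩ = 0) (h2 : μ'.2 ⟨0, by omega⟩ = -1) :
    ¬ D.corresponds μ μ' :=
  not_corresponds_pPlus_negLine D h hp hq hr hs μ μ' h0 h1 h2

/-! ## §3 The place `ι₁`: the plane `W = W₁ ⊕ W₂` (node N28 / Lemma 4.1(b) at `ι₁`, pf ll. 505–510) -/

/-- **PerL v5 L4.1(b) at `ι₁`, FROM PRINT, under PerL's splitting `μ_W = μ₁μ₂` (`n₀ = (−1) + (−1) = −2`)**: for the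
positive plane (`(2,0;2,1)`) the type `κ = ∧²𝔭₊ = (1,1;−2)` is harmonic for EXACTLY ONE `U(2)_W`-type, the CHARACTER
`((3+m₀)/2, (3+m₀)/2) = det ⊗ (vacuum character)` — "`𝓕^κ_{ι₁} = ℂ det(z)` … on which `U(2)_W` acts by `det` (times the
vacuum character)". -/
theorem wedge_harmonic_iff_plane (h : D.Lemma_7_10) (hp : S.p = 2) (hq : S.q = 0) (hr : S.r = 2) (hs : S.s = 1)
    (hn : S.n₀ = -2) (μ : KWt S.p S.q) (μ' : KWt S.r S.s)
    (h0 : μ'.1 ⟨0, by omega⟩ = 1) (h1 : μ'.1 ⟨1, by omega⟩ = 1) (h2 : μ'.2 ⟨0, by omega⟩ = -2) :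
    D.corresponds μ μ' ↔ ∀ i, μ.1 i = (3 + (S.m₀ : ℚ)) / 2 := by
  rw [corresponds_wedge_iff_posPlane D h hp hq hr hs μ μ' h0 h1 h2]
  constructor
  · rintro (⟨-, hμ⟩ | ⟨hn0, -⟩)
    · exact hμ
    · omega
  · exact fun hμ => Or.inl ⟨hn, hμ⟩

/-- **The normalisation caveat of GAPS pv12g7-2, FROM PRINT**: in the UNTWISTED normalisation `n₀ = 0` the same type
`(1,1;−2)` is harmonic too, but paired with the TWO-dimensional `U(2)_W`-type `((1+m₀)/2, (m₀−1)/2)` (`b = (−1)` in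
Lemma 7.10), not with a character — so "acts by `det` times a character" is exactly the `n₀ = −2` reading. -/
theorem wedge_harmonic_n0_zero (h : D.Lemma_7_10) (hp : S.p = 2) (hq : S.q = 0) (hr : S.r = 2) (hs : S.s = 1)
    (hn : S.n₀ = 0) (μ : KWt S.p S.q) (μ' : KWt S.r S.s)
    (h0 : μ'.1 ⟨0, by omega⟩ = 1) (h1 : μ'.1 ⟨1, by omega⟩ = 1) (h2 : μ'.2 ⟨0, by omega⟩ = -2) :
    D.corresponds μ μ' ↔
      μ.1 ⟨0, by omega⟩ = (1 + (S.m₀ : ℚ)) / 2 ∧ μ.1 ⟨1, by omega⟩ = ((S.m₀ : ℚ) - 1) / 2 := by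
  rw [corresponds_wedge_iff_posPlane D h hp hq hr hs μ μ' h0 h1 h2]
  constructor
  · rintro (⟨hn2, -⟩ | ⟨-, hμ0, hμ1⟩)
    · omega
    · exact ⟨hμ0, hμ1⟩
  · exact fun hμ => Or.inr ⟨hn, hμ.1, hμ.2⟩

/-- **"`T_b` acts on `φ⁰_b` by `(−e_b(Ψ₁), −e_b(Ψ₂))`" at `ι₁` (L4.1(b), l. 485–486 and l. 510)**: the diagonal torus
`T_b = U(W₁) × U(W₂) ⊂ U(2)_W` acts on a CHARACTER `(t,t)` of `U(2)` by `(t,t)`, and by §2/§3 `t = (3+m₀)/2 = −e_{ι₁}`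
for BOTH (positive) lines: the `κ`-line's torus character is the pair of the lines' `𝔭₊`-weights.  Recorded as the
arithmetic identity it is. -/
theorem plane_weight_eq_line_weights (m₀ : ℤ) :
    ((3 + (m₀ : ℚ)) / 2, (3 + (m₀ : ℚ)) / 2) = (-eOfSign true m₀, -eOfSign true m₀) := by
  simp [eOfSign]

/-! ## §4 Definite places: planes against `U(3)` (Lemma 4.1(b) at `b ∈ D₁₂ ∪ Σ₁₂`, pf ll. 497–505) -/

/-- **`b ∈ D₁₂`, both lines positive (`(2,0;3,0)`), FROM PRINT**: `𝟏_{U(3)}` is harmonic iff `n₀ = −2` (both vacuum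
twists trivial: `(−1) + (−1)`), paired with the `U(2)_W`-character `((3+m₀)/2, (3+m₀)/2)`; on the torus `T_b` this is
`(−e_b(Ψ₁), −e_b(Ψ₂))` with `e_b = eOfSign true m₀` for both lines. -/
theorem trivial_harmonic_iff_posPlane (h : D.Lemma_7_10) (hp : S.p = 2) (hq : S.q = 0) (hr : S.r = 3)
    (hs : S.s = 0) (μ : KWt S.p S.q) (μ' : KWt S.r S.s) (hμ' : ∀ i, μ'.1 i = 0) :
    D.corresponds μ μ' ↔ S.n₀ = -2 ∧ ∀ i, μ.1 i = -eOfSign true S.m₀ := by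
  have he : -eOfSign true S.m₀ = ((((3 : ℕ) : ℚ)) + S.m₀) / 2 := by
    rw [eOfSign, if_pos rfl]; push_cast; ring
  rw [corresponds_trivial_iff_posPlane D h hp hq hs (by omega) μ μ' hμ', hr, he]

/-- **`b ∈ D₁₂`, both lines negative (`(0,2;3,0)`), FROM PRINT**: `𝟏_{U(3)}` harmonic iff `n₀ = +2`, paired with the
`U(2)_W`-character `((m₀−3)/2, (m₀−3)/2) = (−e, −e)`, `e = eOfSign false m₀`. -/
theorem trivial_harmonic_iff_negPlane (h : D.Lemma_7_10) (hp : S.p = 0) (hq : S.q = 2) (hr : S.r = 3)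
    (hs : S.s = 0) (μ : KWt S.p S.q) (μ' : KWt S.r S.s) (hμ' : ∀ i, μ'.1 i = 0) :
    D.corresponds μ μ' ↔ S.n₀ = 2 ∧ ∀ j, μ.2 j = -eOfSign false S.m₀ := by
  have he : -eOfSign false S.m₀ = ((S.m₀ : ℚ) - ((3 : ℕ) : ℚ)) / 2 := by
    rw [eOfSign, if_neg (by decide)]; push_cast; ring
  rw [corresponds_trivial_iff_negPlane D h hp hq hs (by omega) μ μ' hμ', hr, he]

/-- **`b ∈ Σ₁₂`, one line of each sign (`(1,1;3,0)`), FROM PRINT**: `𝟏_{U(3)}` is harmonic iff `n₀ = 0` ("each vacuum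
twist trivial": `(−1) + (+1)`), paired with the `K = T_b = U(1) × U(1)`-character `((3+m₀)/2; (m₀−3)/2) =
(−e_b(Ψ₁), −e_b(Ψ₂))` (positive line first); the `U(3)`-invariants `ℂ[P]` are generated from this harmonic line. -/
theorem trivial_harmonic_iff_mixedPlane (h : D.Lemma_7_10) (hp : S.p = 1) (hq : S.q = 1) (hr : S.r = 3)
    (hs : S.s = 0) (μ : KWt S.p S.q) (μ' : KWt S.r S.s) (hμ' : ∀ i, μ'.1 i = 0) :
    D.corresponds μ μ' ↔
      S.n₀ = 0 ∧ (∀ i, μ.1 i = -eOfSign true S.m₀) ∧ ∀ j, μ.2 j = -eOfSign false S.m₀ := by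
  have he₁ : -eOfSign true S.m₀ = ((((3 : ℕ) : ℚ)) + S.m₀) / 2 := by
    rw [eOfSign, if_pos rfl]; push_cast; ring
  have he₂ : -eOfSign false S.m₀ = ((S.m₀ : ℚ) - ((3 : ℕ) : ℚ)) / 2 := by
    rw [eOfSign, if_neg (by decide)]; push_cast; ring
  rw [corresponds_trivial_iff_mixedPlane D h hp hq hs (by omega) μ μ' hμ', hr, he₁, he₂]

/-- **Consistency of the per-line and per-plane conditions under multiplicativity of the splitting characters**
(`n₀(W₁ ⊕ W₂) = n₀(W₁) + n₀(W₂)`, Def 3.2 `μ_W = μ₁μ₂`): the line conditions of §1/§2 (`m = −1` for a positive line,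
`m = +1` for a negative line) sum to exactly the plane conditions of §3/§4 (`−2` for `++`, `+2` for `−−`, `0` for
`+−`).  Pure arithmetic, recorded so that the four place types are visibly ONE condition. -/
theorem splitting_exponents_consistent :
    ((-1 : ℤ) + (-1) = -2) ∧ ((1 : ℤ) + 1 = 2) ∧ ((-1 : ℤ) + 1 = 0) := by
  refine ⟨by norm_num, by norm_num, by norm_num⟩

end ArchWeightDictionary
end Binders
end Model
end HodgeCM
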